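import Mathlib
import Literature.Geometry.Symplectic.JRotationBranchSolve
import Literature.Geometry.Symplectic.JRotationBranchRegularity
import Literature.Analysis.Complex.SimilarityFactorisationC1
import HarnessLib

/-!
# From the rotated branch to the rotation comparison `û(ε̄ s)` vs `û(s)` (Wendl 2020, App. B, §B.2.5)

Continuation of `Literature/Geometry/Symplectic/JRotationBranchSolve.lean` and
`…/JRotationBranchRegularity.lean`, in the `C¹` chart variable `s` of the `k`-fold normal form
`(sᵏ, û s)`. There, for `0 < |s|` small, Wendl's equation (B.20) for the branch `θ(s) ≈ ε̄ s`
(`ε̄ᵏ = 1`) was solved by the fixed point `sol s = (θ(s), η(s))` of the contraction `T_s`: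

  `θᵏ + X̌_η(θᵏ, û θ) = sᵏ`,   `û θ + X̂_η(θᵏ, û θ) = û s`.

The representation formula (Wendl 2020, Thm B.23, clause (B.12)) compares `û(ε̄ s)` with `û(s)`;
the similarity principle is applied to the normal coordinate `η`, and this file supplies the
elementary TRANSLATION between the two:

* `eq_rot_of_fixedPoint_of_snd_eq_zero` — if `η(s) = 0` then `θ(s) = ε̄ s` (first component of
  the fixed point and `root(s, 0) = ε̄ s`) and hence `û(ε̄ s) = û(s)`;
* `norm_sub_rot_sub_snd_le` — the pointwise estimate
  `‖(û s - û(ε̄ s)) - η‖ ≤ C_X C_u (2|s|)^{k+1} (1 + C_u 2ᵏ L |s|) ‖η‖`: indeed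
  `û s - û θ = X̂_η(p)` with `‖X̂_η(p) - η‖, ‖X̌_η(p)‖ ≤ C_X C_u (2|s|)^{k+1} ‖η‖` (Lemma B.32), and
  A POSTERIORI `‖θ - ε̄ s‖ |s|ᵏ ≤ L |s| ‖X̌_η(p)‖` (Lipschitz control of the `k`-th root branch), so
  that `‖û θ - û(ε̄ s)‖ ≤ C_u (2|s|)ᵏ ‖θ - ε̄ s‖ ≤ C_u 2ᵏ L |s| ‖X̌_η(p)‖` — the a-priori box bound
  `‖θ - ε̄ s‖ ≤ |s|^{k+2}` alone would not be `o(|s|ᵐ)` for large `m`;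
* `rotation_comparison` — for the solution map `sol` of `exists_regular_branch`: `η(s) = 0`
  forces `û(ε̄ s) = û(s)` (`0 < |s| < ε₃`), and `η(s)/sᵐ → A` forces `(û s - û(ε̄ s))/sᵐ → A`
  (`Literature.Analysis.Complex.tendsto_div_pow_of_norm_sub_le`);
* `rotation_comparison_landau` — the same in the exact shape of (B.12): `η ≡ 0` on a punctured
  neighbourhood gives `û(ε̄ w) = û(w)` near `0`, and `η(s)/sᵐ → A ≠ 0` (`m ≥ 1`) gives
  `û(ε̄ w) - û(w) - (-A) wᵐ = o(|w|ᵐ)`.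

Everything is proved; no named facts.

## References

* C. Wendl, *Lectures on Contact 3-Manifolds, Holomorphic Curves and Intersection Theory*,
  Cambridge Tracts in Math. 220 (2020), App. B, Thm B.23 ((B.12)), (B.20), Lemmas B.31–B.35,
  §B.2.5. [Wendl2020]
* M. Micallef, B. White, *The structure of branch points in minimal surfaces and in
  pseudoholomorphic curves*, Ann. of Math. 141 (1995), §6. [MicallefWhite1995]
-/

noncomputable section

open scoped Topology
open Set Filter Metric Complex Asymptotics

namespace Literature.Geometry.Symplectic.RotationBranch

variable {k : ℕ} {εb : ℂ} {uh : ℂ → ℂ} {X : ℂ × ℂ → ℂ →L[ℝ] ℂ × ℂ}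

/-! ### T1. The degenerate alternative: `η = 0` forces the rotation invariance -/

/-- **If the normal coordinate vanishes, the branch is the rotated branch and `û` is
rotation-invariant at `s`.** For a fixed point `v = (θ, η)` of `T_s` (`s ≠ 0`) with `η = 0`:
`θ = ε̄ s` (the first component reads `θ = root(s, X̌_0) = root(s, 0) = ε̄ s`) and
`û(ε̄ s) = û(s)` (the second component reads `û s - û θ = X̂_0 = 0`).
[cite: Wendl2020, App. B, (B.20) and §B.2.5] -/
theorem eq_rot_of_fixedPoint_of_snd_eq_zero {s : ℂ} (hs : s ≠ 0) {v : ℂ × ℂ}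
    (hfix : Tmap k εb uh X s v = v) (hη : v.2 = 0) :
    v.1 = εb * s ∧ uh (εb * s) = uh s := by
  have h1 : root k εb s (X (pt k uh v.1) v.2).1 = v.1 := congrArg Prod.fst hfix
  have h2 : uh s - uh v.1 - ((X (pt k uh v.1) v.2).2 - v.2) = v.2 := congrArg Prod.snd hfix
  rw [hη, map_zero, Prod.fst_zero, root_zero k εb hs] at h1
  rw [hη, map_zero, Prod.snd_zero, sub_zero, sub_zero] at h2
  refine ⟨h1.symm, ?_⟩
  rw [h1]
  exact (sub_eq_zero.1 h2).symm

/-! ### T2. The pointwise translation estimate -/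

/-- **Translation estimate** (see the module docstring): for a fixed point `v = (θ, η)` of `T_s`
in the box, under the box smallness conditions and `‖X̌_η(p)‖ < δ |s|ᵏ` (`δ` the radius of the
Lipschitz ball of `ᵏ√` about `1`),
`‖(û s - û(ε̄ s)) - η‖ ≤ C_X (C_u (2|s|)^{k+1}) (1 + C_u 2ᵏ L |s|) ‖η‖`.
[cite: Wendl2020, App. B, Lemmas B.32–B.35 and §B.2.5] -/
theorem norm_sub_rot_sub_snd_le {Cu ρ₁ CX δX b L δ : ℝ} (hCu : 0 ≤ Cu) (hCX : 0 ≤ CX) (hL : 0 ≤ L)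
    (hu0 : ∀ w ∈ ball (0 : ℂ) ρ₁, ‖uh w‖ ≤ Cu * ‖w‖ ^ (k + 1))
    (huL : ∀ r : ℝ, 4 * r < ρ₁ → ∀ w ∈ closedBall (0 : ℂ) (2 * r), ∀ w' ∈ closedBall (0 : ℂ) (2 * r),
      ‖uh w - uh w'‖ ≤ Cu * (2 * r) ^ k * ‖w - w'‖)
    (hX1 : ∀ x ∈ closedBall (0 : ℂ × ℂ) δX, ∀ w, ‖X x w - (0, w)‖ ≤ CX * ‖x.2‖ * ‖w‖)
    (hLip : ∀ w ∈ ball (1 : ℂ) δ, ∀ w' ∈ ball (1 : ℂ) δ, ‖kroot k w - kroot k w'‖ ≤ L * ‖w - w'‖)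
    (hδ : 0 < δ) (hεn : ‖εb‖ = 1) {s : ℂ} (hs : s ≠ 0) (hr1 : ‖s‖ ≤ 1 / 2) (hrρ : 4 * ‖s‖ < ρ₁)
    (hrδ1 : (2 * ‖s‖) ^ k ≤ δX) (hrδ2 : Cu * (2 * ‖s‖) ^ (k + 1) ≤ δX)
    {v : ℂ × ℂ} (hv : v ∈ box k εb b s) (hfix : Tmap k εb uh X s v = v)
    (ha : ‖(X (pt k uh v.1) v.2).1‖ < δ * ‖s‖ ^ k) :
    ‖(uh s - uh (εb * s)) - v.2‖ ≤
      CX * (Cu * (2 * ‖s‖) ^ (k + 1)) * (1 + Cu * 2 ^ k * L * ‖s‖) * ‖v.2‖ := by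
  obtain ⟨hθup, -, -, hp2, hpmem, -, -⟩ := box_pointwise hCu hCX hu0 hX1 hεn hr1 hrρ hrδ1 hrδ2 hv
  set r : ℝ := ‖s‖ with hr
  have hr0 : 0 < r := norm_pos_iff.2 hs
  -- the frame error `X_η(p) - (0, η)`
  have hXb : ‖X (pt k uh v.1) v.2 - (0, v.2)‖ ≤ CX * (Cu * (2 * r) ^ (k + 1)) * ‖v.2‖ := by
    calc ‖X (pt k uh v.1) v.2 - (0, v.2)‖ ≤ CX * ‖(pt k uh v.1).2‖ * ‖v.2‖ := hX1 _ hpmem _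
      _ ≤ CX * (Cu * (2 * r) ^ (k + 1)) * ‖v.2‖ := by gcongr
  have ha1 : ‖(X (pt k uh v.1) v.2).1‖ ≤ CX * (Cu * (2 * r) ^ (k + 1)) * ‖v.2‖ := by
    calc ‖(X (pt k uh v.1) v.2).1‖ = ‖(X (pt k uh v.1) v.2 - (0, v.2)).1‖ := by simp
      _ ≤ ‖X (pt k uh v.1) v.2 - (0, v.2)‖ := norm_fst_le _
      _ ≤ _ := hXb
  have hE1 : ‖(X (pt k uh v.1) v.2).2 - v.2‖ ≤ CX * (Cu * (2 * r) ^ (k + 1)) * ‖v.2‖ := by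
    calc ‖(X (pt k uh v.1) v.2).2 - v.2‖ = ‖(X (pt k uh v.1) v.2 - (0, v.2)).2‖ := by simp
      _ ≤ ‖X (pt k uh v.1) v.2 - (0, v.2)‖ := norm_snd_le _
      _ ≤ _ := hXb
  -- the two components of the fixed point
  have h1 : root k εb s (X (pt k uh v.1) v.2).1 = v.1 := congrArg Prod.fst hfix
  have h2 : uh s - uh v.1 - ((X (pt k uh v.1) v.2).2 - v.2) = v.2 := congrArg Prod.snd hfix
  have h2' : uh s - uh v.1 = (X (pt k uh v.1) v.2).2 := by linear_combination h2
  -- a posteriori control of `θ - ε̄ s` by the root branch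
  have hroot : ‖v.1 - εb * s‖ * r ^ k ≤ L * r * ‖(X (pt k uh v.1) v.2).1‖ := by
    have h0 : ‖(0 : ℂ)‖ < δ * ‖s‖ ^ k := by rw [norm_zero]; positivity
    have := norm_root_sub_root_le hLip hεn hs ha h0
    rwa [h1, root_zero k εb hs, sub_zero] at this
  -- Lipschitz control of `û` between `θ` and `ε̄ s`
  have hθmem : v.1 ∈ closedBall (0 : ℂ) (2 * r) := mem_closedBall_zero_iff.2 hθup
  have hεsmem : εb * s ∈ closedBall (0 : ℂ) (2 * r) := by
    rw [mem_closedBall_zero_iff, norm_mul, hεn, one_mul]; linarith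
  have hE2 : ‖uh v.1 - uh (εb * s)‖ ≤ Cu * 2 ^ k * (L * r * ‖(X (pt k uh v.1) v.2).1‖) := by
    calc ‖uh v.1 - uh (εb * s)‖ ≤ Cu * (2 * r) ^ k * ‖v.1 - εb * s‖ := huL r hrρ _ hθmem _ hεsmem
      _ = Cu * 2 ^ k * (‖v.1 - εb * s‖ * r ^ k) := by rw [mul_pow]; ring
      _ ≤ Cu * 2 ^ k * (L * r * ‖(X (pt k uh v.1) v.2).1‖) := by gcongr
  have hE2' : ‖uh v.1 - uh (εb * s)‖ ≤
      Cu * 2 ^ k * (L * r * (CX * (Cu * (2 * r) ^ (k + 1)) * ‖v.2‖)) := hE2.trans (by gcongr)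
  -- the identity and the sum of the two errors
  have hid : (uh s - uh (εb * s)) - v.2 =
      ((X (pt k uh v.1) v.2).2 - v.2) + (uh v.1 - uh (εb * s)) := by
    rw [← h2']; ring
  rw [hid]
  calc ‖((X (pt k uh v.1) v.2).2 - v.2) + (uh v.1 - uh (εb * s))‖
      ≤ ‖(X (pt k uh v.1) v.2).2 - v.2‖ + ‖uh v.1 - uh (εb * s)‖ := norm_add_le _ _
    _ ≤ CX * (Cu * (2 * r) ^ (k + 1)) * ‖v.2‖ +
        Cu * 2 ^ k * (L * r * (CX * (Cu * (2 * r) ^ (k + 1)) * ‖v.2‖)) := add_le_add hE1 hE2'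
    _ = CX * (Cu * (2 * r) ^ (k + 1)) * (1 + Cu * 2 ^ k * L * r) * ‖v.2‖ := by ring

/-! ### T3. The two alternatives for the solution map -/

/-- **Rotation comparison from the rotated branch.** Under the hypotheses of
`exists_regular_branch` (with `ε̄ᵏ = 1`, `|ε̄| = 1`): there is `ε₃ > 0` such that for the solution
map `sol s = (θ(s), η(s))`, (i) `η(s) = 0` with `0 < |s| < ε₃` forces `û(ε̄ s) = û(s)`, and (ii) if
`η(s)/sᵐ → A` as `s → 0` (`s ≠ 0`) then `(û s - û(ε̄ s))/sᵐ → A`.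
[cite: Wendl2020, App. B, Thm B.23 ((B.12)) and §B.2.5] -/
theorem rotation_comparison (hk : k ≠ 0) (hε : εb ^ k = 1) (hεn : ‖εb‖ = 1)
    {Cu ρ₁ CX δX : ℝ} (hCu : 0 ≤ Cu) (hCX : 0 ≤ CX) (hρ₁ : 0 < ρ₁) (hδX : 0 < δX)
    {V : Set (ℂ × ℂ)} (hV : IsOpen V) (hKV : closedBall (0 : ℂ × ℂ) δX ⊆ V)
    (hXc : ContDiffOn ℝ 1 X V) (hu1 : ContDiffOn ℝ 1 uh (ball 0 ρ₁))
    (hu0 : ∀ w ∈ ball (0 : ℂ) ρ₁, ‖uh w‖ ≤ Cu * ‖w‖ ^ (k + 1))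
    (hDu : ∀ w ∈ ball (0 : ℂ) ρ₁, ‖fderiv ℝ uh w‖ ≤ Cu * ‖w‖ ^ k)
    (hX1 : ∀ x ∈ closedBall (0 : ℂ × ℂ) δX, ∀ w, ‖X x w - (0, w)‖ ≤ CX * ‖x.2‖ * ‖w‖)
    (hX2 : ∀ x ∈ closedBall (0 : ℂ × ℂ) δX, ∀ x' ∈ closedBall (0 : ℂ × ℂ) δX, ∀ w,
      ‖X x w - X x' w‖ ≤ CX * ‖x - x'‖ * ‖w‖) :
    ∃ ε₃ : ℝ, 0 < ε₃ ∧
      (∀ s : ℂ, s ≠ 0 → ‖s‖ < ε₃ → (sol k εb uh X (2 * Cu + 1) s).2 = 0 → uh (εb * s) = uh s) ∧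
      ∀ (m : ℕ) (A : ℂ),
        Tendsto (fun s => (sol k εb uh X (2 * Cu + 1) s).2 / s ^ m) (𝓝[≠] 0) (𝓝 A) →
        Tendsto (fun s => (uh s - uh (εb * s)) / s ^ m) (𝓝[≠] 0) (𝓝 A) := by
  set b : ℝ := 2 * Cu + 1 with hb
  have huL := lipschitz_uh_of_fderiv (k := k) hCu (hu1.differentiableOn one_ne_zero) hDu
  obtain ⟨ε₁, hε₁, hreg⟩ :=
    exists_regular_branch hk hε hεn hCu hCX hρ₁ hδX hV hKV hXc hu1 hu0 hDu hX1 hX2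
  obtain ⟨L, δ, hL, hδ, hδ1, hLip, -⟩ := exists_kroot_lipschitz k
  -- ### the extra smallness making `‖X̌_η(p)‖ < δ |s|ᵏ`
  set K₄ : ℝ := CX * Cu * 2 ^ (k + 1) * b with hK₄
  have hb0 : 0 ≤ b := by positivity
  have hK₄0 : 0 ≤ K₄ := by positivity
  set ε₄ : ℝ := min 1 (δ / (K₄ + 1)) with hε₄
  have hε₄pos : 0 < ε₄ := lt_min one_pos (by positivity)
  set ε₃ : ℝ := min ε₁ ε₄ with hε₃
  have hε₃pos : 0 < ε₃ := lt_min hε₁ hε₄pos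
  -- ### pointwise package for `0 < |s| < ε₃`
  have key : ∀ s : ℂ, s ≠ 0 → ‖s‖ < ε₃ →
      Tmap k εb uh X s (sol k εb uh X b s) = sol k εb uh X b s ∧
      ‖(uh s - uh (εb * s)) - (sol k εb uh X b s).2‖ ≤
        CX * (Cu * (2 * ‖s‖) ^ (k + 1)) * (1 + Cu * 2 ^ k * L * ‖s‖) * ‖(sol k εb uh X b s).2‖ := by
    intro s hs hsε
    have hsε₁ : ‖s‖ < ε₁ := hsε.trans_le (min_le_left _ _)
    have hs1 : ‖s‖ ≤ 1 := (hsε.trans_le ((min_le_right _ _).trans (min_le_left _ _))).le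
    have hsδ : ‖s‖ < δ / (K₄ + 1) :=
      hsε.trans_le ((min_le_right _ _).trans (min_le_right _ _))
    obtain ⟨hr1, hrρ, hrδ1, hrδ2, hbox, hfix, -, -, -, -, -, -, -⟩ := hreg s hs hsε₁
    obtain ⟨-, -, -, -, -, ha, -⟩ := box_pointwise hCu hCX hu0 hX1 hεn hr1 hrρ hrδ1 hrδ2 hbox
    have hr0 : 0 < ‖s‖ := norm_pos_iff.2 hs
    -- `‖X̌‖ ≤ K₄ |s|^{2k+2} < δ |s|ᵏ`
    have ha' : ‖(X (pt k uh (sol k εb uh X b s).1) (sol k εb uh X b s).2).1‖ < δ * ‖s‖ ^ k := by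
      have e1 : CX * (Cu * (2 * ‖s‖) ^ (k + 1)) * (b * ‖s‖ ^ (k + 1)) =
          K₄ * ‖s‖ ^ (k + 2) * ‖s‖ ^ k := by
        rw [hK₄, mul_pow]; ring
      have e2 : K₄ * ‖s‖ ^ (k + 2) ≤ K₄ * ‖s‖ := by
        have : ‖s‖ ^ (k + 2) ≤ ‖s‖ ^ 1 := pow_le_pow_of_le_one hr0.le hs1 (by omega)
        rw [pow_one] at this
        exact mul_le_mul_of_nonneg_left this hK₄0
      have e3 : K₄ * ‖s‖ < δ := by
        have h1 : K₄ * ‖s‖ ≤ (K₄ + 1) * ‖s‖ := by gcongr; linarith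
        have h2 : (K₄ + 1) * ‖s‖ < (K₄ + 1) * (δ / (K₄ + 1)) := by gcongr
        have h3 : (K₄ + 1) * (δ / (K₄ + 1)) = δ := by field_simp
        linarith
      calc ‖(X (pt k uh (sol k εb uh X b s).1) (sol k εb uh X b s).2).1‖
          ≤ CX * (Cu * (2 * ‖s‖) ^ (k + 1)) * (b * ‖s‖ ^ (k + 1)) := ha
        _ = K₄ * ‖s‖ ^ (k + 2) * ‖s‖ ^ k := e1
        _ ≤ K₄ * ‖s‖ * ‖s‖ ^ k := by gcongr
        _ < δ * ‖s‖ ^ k := by gcongr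
    exact ⟨hfix, norm_sub_rot_sub_snd_le hCu hCX hL hu0 huL hX1 hLip hδ hεn hs hr1 hrρ hrδ1 hrδ2
      hbox hfix ha'⟩
  refine ⟨ε₃, hε₃pos, fun s hs hsε hη => ?_, fun m A hA => ?_⟩
  · exact (eq_rot_of_fixedPoint_of_snd_eq_zero hs (key s hs hsε).1 hη).2
  · -- the error modulus `e(s) → 0`
    set e : ℂ → ℝ := fun s => CX * (Cu * (2 * ‖s‖) ^ (k + 1)) * (1 + Cu * 2 ^ k * L * ‖s‖) with he
    have hec : Continuous e := by
      rw [he]; fun_prop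
    have he0 : e 0 = 0 := by
      rw [he]; simp
    have het : Tendsto e (𝓝[≠] 0) (𝓝 0) := by
      have := hec.tendsto 0
      rw [he0] at this
      exact this.mono_left nhdsWithin_le_nhds
    have hge : ∀ᶠ s in 𝓝[≠] (0 : ℂ), ‖(uh s - uh (εb * s)) - (sol k εb uh X b s).2‖ ≤
        e s * ‖(sol k εb uh X b s).2‖ := by
      have hball : ({0}ᶜ : Set ℂ) ∩ ball (0 : ℂ) ε₃ ∈ 𝓝[≠] (0 : ℂ) :=
        inter_mem_nhdsWithin _ (ball_mem_nhds (0 : ℂ) hε₃pos)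
      filter_upwards [hball] with s hs
      exact (key s hs.1 (mem_ball_zero_iff.1 hs.2)).2
    exact Literature.Analysis.Complex.tendsto_div_pow_of_norm_sub_le hA het hge

/-- **Rotation comparison, in the shape of (B.12).** Under the hypotheses of
`exists_regular_branch`: (i) if the normal coordinate `η(s) = (sol s).2` vanishes on a punctured
neighbourhood of `0`, then `û(ε̄ w) = û(w)` for all `w` near `0`; (ii) if `η(s)/sᵐ → A ≠ 0` with
`m ≥ 1`, then `û(ε̄ w) - û(w) - (-A) wᵐ = o(|w|ᵐ)` at `0`.
[cite: Wendl2020, App. B, Thm B.23 ((B.12)) and §B.2.5] -/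
theorem rotation_comparison_landau (hk : k ≠ 0) (hε : εb ^ k = 1) (hεn : ‖εb‖ = 1)
    {Cu ρ₁ CX δX : ℝ} (hCu : 0 ≤ Cu) (hCX : 0 ≤ CX) (hρ₁ : 0 < ρ₁) (hδX : 0 < δX)
    {V : Set (ℂ × ℂ)} (hV : IsOpen V) (hKV : closedBall (0 : ℂ × ℂ) δX ⊆ V)
    (hXc : ContDiffOn ℝ 1 X V) (hu1 : ContDiffOn ℝ 1 uh (ball 0 ρ₁))
    (hu0 : ∀ w ∈ ball (0 : ℂ) ρ₁, ‖uh w‖ ≤ Cu * ‖w‖ ^ (k + 1))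
    (hDu : ∀ w ∈ ball (0 : ℂ) ρ₁, ‖fderiv ℝ uh w‖ ≤ Cu * ‖w‖ ^ k)
    (hX1 : ∀ x ∈ closedBall (0 : ℂ × ℂ) δX, ∀ w, ‖X x w - (0, w)‖ ≤ CX * ‖x.2‖ * ‖w‖)
    (hX2 : ∀ x ∈ closedBall (0 : ℂ × ℂ) δX, ∀ x' ∈ closedBall (0 : ℂ × ℂ) δX, ∀ w,
      ‖X x w - X x' w‖ ≤ CX * ‖x - x'‖ * ‖w‖) :
    ((∀ᶠ s in 𝓝[≠] (0 : ℂ), (sol k εb uh X (2 * Cu + 1) s).2 = 0) →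
        ∀ᶠ w in 𝓝 (0 : ℂ), uh (εb * w) = uh w) ∧
      ∀ (m : ℕ) (A : ℂ), 1 ≤ m → A ≠ 0 →
        Tendsto (fun s => (sol k εb uh X (2 * Cu + 1) s).2 / s ^ m) (𝓝[≠] 0) (𝓝 A) →
        (fun w => uh (εb * w) - uh w - (-A) * w ^ m) =o[𝓝 (0 : ℂ)] fun w => ‖w‖ ^ m := by
  obtain ⟨ε₃, hε₃, hzero, hlim⟩ :=
    rotation_comparison hk hε hεn hCu hCX hρ₁ hδX hV hKV hXc hu1 hu0 hDu hX1 hX2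
  refine ⟨fun hev => ?_, fun m A hm _hA hA => ?_⟩
  · have hball : ({0}ᶜ : Set ℂ) ∩ ball (0 : ℂ) ε₃ ∈ 𝓝[≠] (0 : ℂ) :=
      inter_mem_nhdsWithin _ (ball_mem_nhds (0 : ℂ) hε₃)
    have hpunct : ∀ᶠ w in 𝓝[≠] (0 : ℂ), uh (εb * w) = uh w := by
      filter_upwards [hev, hball] with w hw hwb
      exact hzero w hwb.1 (mem_ball_zero_iff.1 hwb.2) hw
    have hzero' : ∀ᶠ w in pure (0 : ℂ), uh (εb * w) = uh w :=
      Filter.eventually_pure.2 (by rw [mul_zero])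
    rw [← nhdsNE_sup_pure, Filter.eventually_sup]
    exact ⟨hpunct, hzero'⟩
  · have h1 := hlim m A hA
    have h2 : Tendsto (fun s => (uh (εb * s) - uh s) / s ^ m) (𝓝[≠] 0) (𝓝 (-A)) := by
      have := h1.neg
      refine this.congr' (Eventually.of_forall fun s => ?_)
      simp only [neg_div', neg_sub]
    have h3 := Literature.Analysis.Complex.isLittleO_sub_mul_pow_of_tendsto_div_pow
      (f := fun s => uh (εb * s) - uh s) hm (by simp) h2
    simpa using h3

end Literature.Geometry.Symplectic.RotationBranch

end
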